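import Literature.NumberTheory.EllipticCurves.TateCurve.Invariants
import HarnessLib

/-!
# Route `ClassRecordThree`, crux `SchneiderAtThree` (item 19106), BC5 rung `stub_rung_62310y1`: the KERNEL EVALUATOR,
# part 2 — the `cosh` series and the Tate sigma product to precision `O(3²)`
# (cell `bsd-stepL`, seat `bsd-stepL-reg3-eng` g2; `--supports stmt-BirchSwinnertonDyer-19106`; plan
# `run/shared/lean/pub/bsd-stepL/reg3/FORMALISATION-SPEC.md` groups D, E)

HONEST FRAMING: BSD is not proved by any of this; nothing here closes the crux or the rung leaf; Schneider's conjecture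
is asserted nowhere. Part 1 (`…Rung62310y1HeightEval`, p424748) reduced the rung's one numerical inequality HH to the
bound `‖σ² − 18‖₃ ≤ 3⁻⁴` for `σ² = tateSigmaSq q (coshOfSq w)`, `w = logUnitParamSq W 3 q x y`. This file takes that
bound down to the formal group: it holds as soon as `‖w − 72‖₃ ≤ 3⁻⁴` (`w ≡ −9 mod 81`), for every `‖q‖₃ ≤ 3⁻¹`
(theorems only, 0 defs, 0 facts; all over `ℚ₃`):

* §D `summable_coshOfSq_term` (`‖w‖ ≤ 3⁻²`), `norm_coshOfSq_sub_le` (**`‖ch(w) − 1 − w/2 − w²/24‖ ≤ 3⁻⁴`**: the `n = 3`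
  term has norm `‖w‖³·‖1/720‖₃ ≤ 3⁻⁴`, the terms `n ≥ 4` have norm `≤ 3⁻ⁿ` by Legendre `v₃((2n)!) ≤ n`), and
  `norm_coshOfSq_sub_one_sub_nine_le` (**`‖w − 72‖ ≤ 3⁻⁴ ⇒ ‖(ch(w) − 1) − 9‖ ≤ 3⁻⁴`**).
* §E `norm_tateSigmaSq_factor_sub_one_le` (each factor `(1 − 2qⁿc + q²ⁿ)²/(1 − qⁿ)⁴` is `1 + O(qⁿ(c − 1))`),
  `multipliable_tateSigmaSq_factor`, `norm_tprod_tateSigmaSq_factor_sub_one_le` (`‖Π − 1‖ ≤ ‖q‖·‖c − 1‖`, the tree's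
  `norm_prod_sub_prod_le` passed to the limit as in `norm_tprod_tateDelta_factor_sub_le`) and
  `norm_tateSigmaSq_sub_le` (**`‖q‖ ≤ 3⁻¹`, `‖(c − 1) − 9‖ ≤ 3⁻⁴ ⇒ ‖tateSigmaSq q c − 18‖ ≤ 3⁻⁴`**).
* `norm_tateSigmaSq_coshOfSq_sub_le`: the two combined — `‖q‖ ≤ 3⁻¹`, `‖w − 72‖ ≤ 3⁻⁴ ⇒ ‖σ² − 18‖ ≤ 3⁻⁴`.

What then remains of HH (part 3): `‖w − 72‖₃ ≤ 3⁻⁴` for `w = L²/C²`, `L = log_Ŵ(z(Q))`, i.e. the cubic expansion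
`log_W(z) = z + (a₁/2)z² + ((a₁² + a₂)/3)z³ + O(z⁴)` of the tree's `formalLog` (FORMALISATION-SPEC group C).

References: [SteinWuthrich2013] §4.2 (`σ_q(u)`, `C`); [SilvermanATAEC1994] V.3 (Tate curve); [SilvermanAEC2009] IV.6.3
(Legendre-type valuation bounds).
-/

open scoped Classical

open Filter Topology IsUltrametricDist WeierstrassCurve Literature.NumberTheory.EllipticCurves
  Literature.NumberTheory.EllipticCurves.SteinWuthrich2013

namespace Summit.BirchSwinnertonDyer.Rank1Residual.X11b.RegMult.Rung62310y1

/-! ### §0 Plumbing -/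

/-- Ultrametric inequality for differences. [folklore] -/
private theorem norm_sub_le_max'' (a b : ℚ_[3]) : ‖a - b‖ ≤ max ‖a‖ ‖b‖ := by
  rw [sub_eq_add_neg, ← norm_neg b]; exact IsUltrametricDist.norm_add_le_max a (-b)

/-- **Legendre at `p = 3`**: `‖1/(2n)!‖₃ ≤ 3ⁿ` (`2·v₃((2n)!) = 2n − s₃(2n) ≤ 2n`). [Silverman AEC IV.6.3(a)] [folklore] -/
private theorem norm_inv_factorial_le (n : ℕ) : ‖(((2 * n).factorial : ℕ) : ℚ_[3])⁻¹‖ ≤ (3 : ℝ) ^ n := by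
  have hf : ((2 * n).factorial : ℕ) ≠ 0 := Nat.factorial_ne_zero _
  rw [norm_inv, Padic.norm_eq_zpow_neg_valuation (by exact_mod_cast hf), Padic.valuation_natCast, zpow_neg,
    inv_inv, zpow_natCast]
  have hv : padicValNat 3 (2 * n).factorial ≤ n := by
    have h := sub_one_mul_padicValNat_factorial (p := 3) (2 * n)
    have hs : (3 - 1) * padicValNat 3 (2 * n).factorial ≤ 2 * n := by rw [h]; exact Nat.sub_le _ _
    omega
  exact_mod_cast Nat.pow_le_pow_right (by norm_num) hv

/-! ### §D The `cosh` series `ch(w) = Σ wⁿ/(2n)!` at `‖w‖₃ ≤ 3⁻²` -/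

/-- The general term of `coshOfSq w` has norm `≤ 3⁻ⁿ` for `‖w‖₃ ≤ 3⁻²`. [folklore] -/
private theorem norm_coshOfSq_term_le {w : ℚ_[3]} (hw : ‖w‖ ≤ 1 / 9) (n : ℕ) :
    ‖w ^ n / (((2 * n).factorial : ℕ) : ℚ_[3])‖ ≤ (1 / 3 : ℝ) ^ n := by
  rw [div_eq_mul_inv, norm_mul, norm_pow]
  calc ‖w‖ ^ n * ‖(((2 * n).factorial : ℕ) : ℚ_[3])⁻¹‖ ≤ (1 / 9 : ℝ) ^ n * (3 : ℝ) ^ n := by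
        gcongr; exact norm_inv_factorial_le n
    _ = (1 / 3 : ℝ) ^ n := by rw [← mul_pow]; norm_num

/-- `coshOfSq` converges at `‖w‖₃ ≤ 3⁻²` (geometric majorant `3⁻ⁿ`). [folklore] -/
theorem summable_coshOfSq_term {w : ℚ_[3]} (hw : ‖w‖ ≤ 1 / 9) :
    Summable fun n : ℕ ↦ w ^ n / (((2 * n).factorial : ℕ) : ℚ_[3]) := by
  refine Summable.of_norm_bounded (summable_geometric_of_lt_one (by norm_num) (by norm_num : (1 / 3 : ℝ) < 1)) ?_
  intro n; exact norm_coshOfSq_term_le hw n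

/-- **`‖ch(w) − (1 + w/2 + w²/24)‖₃ ≤ 3⁻⁴` for `‖w‖₃ ≤ 3⁻²`**: split off the terms `n ≤ 3`; the cubic term has norm
`‖w‖³·‖1/720‖₃ = 9‖w‖³ ≤ 3⁻⁴`, every later term `≤ 3⁻ⁿ ≤ 3⁻⁴` (ultrametric `tsum` bound). [folklore] -/
theorem norm_coshOfSq_sub_le {w : ℚ_[3]} (hw : ‖w‖ ≤ 1 / 9) :
    ‖coshOfSq w - (1 + w / 2 + w ^ 2 / 24)‖ ≤ 1 / 81 := by
  have hs := summable_coshOfSq_term hw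
  have hsplit := hs.sum_add_tsum_nat_add 4
  -- `coshOfSq w` is this `tsum` (the definition casts `(2n)!` through `K`)
  have hdef : coshOfSq w = ∑' n : ℕ, w ^ n / (((2 * n).factorial : ℕ) : ℚ_[3]) := by
    rw [coshOfSq]
  rw [hdef, ← hsplit]
  simp only [Finset.sum_range_succ, Finset.sum_range_zero, zero_add, pow_zero, Nat.mul_zero, Nat.factorial_zero,
    Nat.cast_one, div_one, pow_one]
  have h2 : (((2 * 1).factorial : ℕ) : ℚ_[3]) = 2 := by norm_num [Nat.factorial]
  have h24 : (((2 * 2).factorial : ℕ) : ℚ_[3]) = 24 := by norm_num [Nat.factorial]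
  have h720 : (((2 * 3).factorial : ℕ) : ℚ_[3]) = 720 := by norm_num [Nat.factorial]
  rw [h2, h24, h720]
  have hring : 1 + w / 2 + w ^ 2 / 24 + w ^ 3 / 720 +
      ∑' n : ℕ, w ^ (n + 4) / (((2 * (n + 4)).factorial : ℕ) : ℚ_[3]) - (1 + w / 2 + w ^ 2 / 24) =
      w ^ 3 / 720 + ∑' n : ℕ, w ^ (n + 4) / (((2 * (n + 4)).factorial : ℕ) : ℚ_[3]) := by ring
  rw [hring]
  refine (IsUltrametricDist.norm_add_le_max _ _).trans (max_le ?_ ?_)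
  · -- the cubic term
    have h720n : ‖((720 : ℚ_[3]))⁻¹‖ = 9 := by
      rw [norm_inv, show (720 : ℚ_[3]) = ((720 : ℕ) : ℚ_[3]) by norm_cast,
        Padic.norm_eq_zpow_neg_valuation (by norm_num), Padic.valuation_natCast]
      have : padicValNat 3 720 = 2 := by
        have h1 : 2 ≤ padicValNat 3 720 := (padicValNat_dvd_iff_le (by norm_num)).mp (by norm_num)
        have h2 : ¬ 3 ≤ padicValNat 3 720 := fun h => by
          have := (padicValNat_dvd_iff_le (p := 3) (n := 3) (by norm_num : (720 : ℕ) ≠ 0)).mpr h; norm_num at this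
        omega
      rw [this]; norm_num
    rw [div_eq_mul_inv, norm_mul, norm_pow, h720n]
    calc ‖w‖ ^ 3 * 9 ≤ (1 / 9 : ℝ) ^ 3 * 9 := by gcongr
      _ ≤ 1 / 81 := by norm_num
  · refine IsUltrametricDist.norm_tsum_le_of_forall_le_of_nonneg (by norm_num) fun n ↦ ?_
    refine (norm_coshOfSq_term_le hw (n + 4)).trans ?_
    calc (1 / 3 : ℝ) ^ (n + 4) = (1 / 3) ^ n * (1 / 81) := by rw [pow_add]; norm_num
      _ ≤ 1 * (1 / 81) := by gcongr; exact pow_le_one₀ (by norm_num) (by norm_num)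
      _ = 1 / 81 := one_mul _

/-- **`w ≡ −9 (mod 81) ⇒ ch(w) − 1 ≡ 9 (mod 81)`**: with `‖w − 72‖₃ ≤ 3⁻⁴` one has `‖w‖ = 3⁻²`,
`‖w/2 − 36‖ ≤ 3⁻⁴`, `‖w²/24 − 54‖ = ‖(w − 36)(w + 36)/24‖ ≤ 3·3⁻²·3⁻³ = 3⁻⁴`, and `36 + 54 + … ≡ 9`. [folklore] -/
theorem norm_coshOfSq_sub_one_sub_nine_le {w : ℚ_[3]} (hw : ‖w - 72‖ ≤ 1 / 81) :
    ‖(coshOfSq w - 1) - 9‖ ≤ 1 / 81 := by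
  have h72 : ‖(72 : ℚ_[3])‖ = 1 / 9 := by
    rw [show (72 : ℚ_[3]) = ((72 : ℕ) : ℚ_[3]) by norm_cast, Padic.norm_eq_zpow_neg_valuation (by norm_num),
      Padic.valuation_natCast]
    have : padicValNat 3 72 = 2 := by
      have h1 : 2 ≤ padicValNat 3 72 := (padicValNat_dvd_iff_le (by norm_num)).mp (by norm_num)
      have h2 : ¬ 3 ≤ padicValNat 3 72 := fun h => by
        have := (padicValNat_dvd_iff_le (p := 3) (n := 3) (by norm_num : (72 : ℕ) ≠ 0)).mpr h; norm_num at this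
      omega
    rw [this]; norm_num
  have hwn : ‖w‖ = 1 / 9 := by
    rw [← h72]; exact Padic.norm_eq_of_norm_sub_lt_right (hw.trans_lt (by rw [h72]; norm_num))
  have hc := norm_coshOfSq_sub_le hwn.le
  have hsplit : (coshOfSq w - 1) - 9 =
      (coshOfSq w - (1 + w / 2 + w ^ 2 / 24)) + ((w - 72) / 2 + (w - 36) * (w + 36) / 24) + 81 := by ring
  rw [hsplit]
  have h81 : ‖(81 : ℚ_[3])‖ ≤ 1 / 81 := by
    rw [show (81 : ℚ_[3]) = ((81 : ℤ) : ℚ_[3]) by norm_cast]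
    exact ((Padic.norm_int_le_pow_iff_dvd (p := 3) 81 4).mpr (by norm_num)).trans (by norm_num)
  refine (IsUltrametricDist.norm_add_le_max _ _).trans (max_le ?_ h81)
  refine (IsUltrametricDist.norm_add_le_max _ _).trans (max_le hc ?_)
  have h2 : ‖(2 : ℚ_[3])‖ = 1 := by
    rw [show (2 : ℚ_[3]) = ((2 : ℕ) : ℚ_[3]) by norm_cast, Padic.norm_eq_zpow_neg_valuation (by norm_num),
      Padic.valuation_natCast, padicValNat.eq_zero_of_not_dvd (by norm_num)]; norm_num
  have h24 : ‖(24 : ℚ_[3])‖ = 1 / 3 := by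
    rw [show (24 : ℚ_[3]) = ((24 : ℕ) : ℚ_[3]) by norm_cast, Padic.norm_eq_zpow_neg_valuation (by norm_num),
      Padic.valuation_natCast]
    have : padicValNat 3 24 = 1 := by
      have h1 : 1 ≤ padicValNat 3 24 := (padicValNat_dvd_iff_le (by norm_num)).mp (by norm_num)
      have h2 : ¬ 2 ≤ padicValNat 3 24 := fun h => by
        have := (padicValNat_dvd_iff_le (p := 3) (n := 2) (by norm_num : (24 : ℕ) ≠ 0)).mpr h; norm_num at this
      omega
    rw [this]; norm_num
  have h108 : ‖(108 : ℚ_[3])‖ ≤ 1 / 27 := by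
    rw [show (108 : ℚ_[3]) = ((108 : ℤ) : ℚ_[3]) by norm_cast]
    exact ((Padic.norm_int_le_pow_iff_dvd (p := 3) 108 3).mpr (by norm_num)).trans (by norm_num)
  have hA : ‖(w - 72) / 2‖ ≤ 1 / 81 := by rw [norm_div, h2, div_one]; exact hw
  have hB1 : ‖w - 36‖ ≤ 1 / 9 := by
    have : w - 36 = (w - 72) + 36 := by ring
    rw [this]
    refine (IsUltrametricDist.norm_add_le_max _ _).trans (max_le (hw.trans (by norm_num)) ?_)
    rw [show (36 : ℚ_[3]) = ((36 : ℤ) : ℚ_[3]) by norm_cast]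
    exact ((Padic.norm_int_le_pow_iff_dvd (p := 3) 36 2).mpr (by norm_num)).trans (by norm_num)
  have hB2 : ‖w + 36‖ ≤ 1 / 27 := by
    have : w + 36 = (w - 72) + 108 := by ring
    rw [this]
    exact (IsUltrametricDist.norm_add_le_max _ _).trans (max_le (hw.trans (by norm_num)) h108)
  have hB : ‖(w - 36) * (w + 36) / 24‖ ≤ 1 / 81 := by
    rw [norm_div, norm_mul, h24]
    calc ‖w - 36‖ * ‖w + 36‖ / (1 / 3) ≤ 1 / 9 * (1 / 27) / (1 / 3) := by gcongr
      _ = 1 / 81 := by norm_num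
  exact (IsUltrametricDist.norm_add_le_max _ _).trans (max_le hA hB)

/-! ### §E The Tate sigma product `Π = ∏_{n ≥ 1} (1 − 2qⁿc + q²ⁿ)²/(1 − qⁿ)⁴` -/

/-- `‖1 − Q‖ = 1` for `‖Q‖ < 1`. [folklore] -/
private theorem norm_one_sub_eq_one {Q : ℚ_[3]} (hQ : ‖Q‖ < 1) : ‖1 - Q‖ = 1 := by
  have h : ‖((1 : ℚ_[3]) - Q) - 1‖ < ‖(1 : ℚ_[3])‖ := by
    rw [show ((1 : ℚ_[3]) - Q) - 1 = -Q by ring, norm_neg, norm_one]; exact hQ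
  rw [Padic.norm_eq_of_norm_sub_lt_right h, norm_one]

/-- **Each sigma factor is `1 + O(qⁿ(c − 1))`**: for `‖Q‖ < 1` and `‖c‖ ≤ 1`,
`‖(1 − 2Qc + Q²)²/(1 − Q)⁴ − 1‖ ≤ ‖Q‖·‖c − 1‖` (`A = 1 − 2Qc + Q²`, `B = (1−Q)²`, `A − B = −2Q(c − 1)`,
`A² − B² = (A − B)(A + B)`, `‖B‖ = 1`). [cite: SteinWuthrich2013, §4.2] -/
theorem norm_tateSigmaSq_factor_sub_one_le {Q c : ℚ_[3]} (hQ : ‖Q‖ < 1) (hc : ‖c‖ ≤ 1) :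
    ‖(1 - 2 * Q * c + Q ^ 2) ^ 2 / (1 - Q) ^ 4 - 1‖ ≤ ‖Q‖ * ‖c - 1‖ := by
  have hB : ‖(1 - Q) ^ 4‖ = 1 := by rw [norm_pow, norm_one_sub_eq_one hQ, one_pow]
  have hB0 : (1 - Q) ^ 4 ≠ 0 := by intro h; rw [h, norm_zero] at hB; exact zero_ne_one hB
  rw [div_sub_one hB0, norm_div, hB, div_one]
  have hfac : (1 - 2 * Q * c + Q ^ 2) ^ 2 - (1 - Q) ^ 4 =
      (-2 * Q * (c - 1)) * ((1 - 2 * Q * c + Q ^ 2) + (1 - Q) ^ 2) := by ring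
  rw [hfac, norm_mul]
  have h2 : ‖(-2 : ℚ_[3])‖ ≤ 1 := by
    rw [show (-2 : ℚ_[3]) = ((-2 : ℤ) : ℚ_[3]) by norm_cast]; exact Padic.norm_int_le_one _
  have hQ1 : ‖Q‖ ≤ 1 := hQ.le
  have hsum : ‖(1 - 2 * Q * c + Q ^ 2) + (1 - Q) ^ 2‖ ≤ 1 := by
    refine (IsUltrametricDist.norm_add_le_max _ _).trans (max_le ?_ ?_)
    · refine (IsUltrametricDist.norm_add_le_max _ _).trans (max_le ?_ ?_)
      · refine (norm_sub_le_max'' _ _).trans (max_le (by rw [norm_one]) ?_)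
        rw [norm_mul, norm_mul]
        calc ‖(2 : ℚ_[3])‖ * ‖Q‖ * ‖c‖ ≤ 1 * 1 * 1 := by
              gcongr
              rw [show (2 : ℚ_[3]) = ((2 : ℤ) : ℚ_[3]) by norm_cast]; exact Padic.norm_int_le_one _
          _ = 1 := by norm_num
      · rw [norm_pow]; exact pow_le_one₀ (norm_nonneg _) hQ1
    · rw [norm_pow, norm_one_sub_eq_one hQ, one_pow]
  calc ‖-2 * Q * (c - 1)‖ * ‖(1 - 2 * Q * c + Q ^ 2) + (1 - Q) ^ 2‖ ≤ ‖-2 * Q * (c - 1)‖ * 1 := by gcongr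
    _ = ‖(-2 : ℚ_[3])‖ * (‖Q‖ * ‖c - 1‖) := by rw [mul_one, norm_mul, norm_mul, mul_assoc]
    _ ≤ 1 * (‖Q‖ * ‖c - 1‖) := by gcongr
    _ = ‖Q‖ * ‖c - 1‖ := one_mul _

/-- The sigma factors are multipliable for `‖q‖ < 1`, `‖c‖ ≤ 1` (`Σ ‖f_n − 1‖` has a geometric majorant;
Mathlib `multipliable_one_add_of_summable`, as the tree's `multipliable_tateDelta_factor`). [folklore] -/
theorem multipliable_tateSigmaSq_factor {q c : ℚ_[3]} (hq : ‖q‖ < 1) (hc : ‖c‖ ≤ 1) :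
    Multipliable fun n : ℕ ↦ (1 - 2 * q ^ (n + 1) * c + q ^ (2 * (n + 1))) ^ 2 / (1 - q ^ (n + 1)) ^ 4 := by
  have heq : (fun n : ℕ ↦ (1 - 2 * q ^ (n + 1) * c + q ^ (2 * (n + 1))) ^ 2 / (1 - q ^ (n + 1)) ^ 4) =
      fun n : ℕ ↦ 1 + ((1 - 2 * q ^ (n + 1) * c + (q ^ (n + 1)) ^ 2) ^ 2 / (1 - q ^ (n + 1)) ^ 4 - 1) := by
    funext n; rw [← pow_mul, mul_comm (n + 1) 2]; ring
  rw [heq]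
  refine multipliable_one_add_of_summable ?_
  refine Summable.of_nonneg_of_le (fun _ ↦ norm_nonneg _) (fun n ↦ ?_)
    (((summable_geometric_of_lt_one (norm_nonneg q) hq).mul_right ‖q‖).mul_right ‖c - 1‖)
  have hqn : ‖q ^ (n + 1)‖ < 1 := by rw [norm_pow]; exact pow_lt_one₀ (norm_nonneg _) hq (by omega)
  refine (norm_tateSigmaSq_factor_sub_one_le hqn hc).trans (le_of_eq ?_)
  rw [norm_pow, pow_succ]

/-- **`‖Π − 1‖ ≤ ‖q‖·‖c − 1‖`** for the Tate sigma product (`‖q‖ < 1`, `‖c‖ ≤ 1`): every partial product is within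
`‖q‖·‖c − 1‖` of `1` (`norm_prod_sub_prod_le`), pass to the limit. [cite: SteinWuthrich2013, §4.2] -/
theorem norm_tprod_tateSigmaSq_factor_sub_one_le {q c : ℚ_[3]} (hq : ‖q‖ < 1) (hc : ‖c‖ ≤ 1) :
    ‖(∏' n : ℕ, (1 - 2 * q ^ (n + 1) * c + q ^ (2 * (n + 1))) ^ 2 / (1 - q ^ (n + 1)) ^ 4) - 1‖ ≤
      ‖q‖ * ‖c - 1‖ := by
  have hP0 := (multipliable_tateSigmaSq_factor hq hc).hasProd
  have h1 : Tendsto (fun s : Finset ℕ ↦ ∏ n ∈ s, (1 : ℚ_[3])) atTop (𝓝 1) := by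
    simp only [Finset.prod_const_one]; exact tendsto_const_nhds
  have hP := (hP0.sub h1).norm
  refine le_of_tendsto' hP fun s ↦ ?_
  have hC : 0 ≤ ‖q‖ * ‖c - 1‖ := by positivity
  refine norm_prod_sub_prod_le hC (fun n ↦ ?_) (fun _ ↦ by rw [norm_one]) (fun n ↦ ?_) s
  · -- each factor has norm ≤ 1 (indeed = 1)
    have hqn : ‖q ^ (n + 1)‖ < 1 := by rw [norm_pow]; exact pow_lt_one₀ (norm_nonneg _) hq (by omega)
    have h := norm_tateSigmaSq_factor_sub_one_le hqn hc
    have hlt : ‖(1 - 2 * q ^ (n + 1) * c + (q ^ (n + 1)) ^ 2) ^ 2 / (1 - q ^ (n + 1)) ^ 4 - 1‖ < 1 := by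
      refine h.trans_lt ?_
      calc ‖q ^ (n + 1)‖ * ‖c - 1‖ ≤ ‖q ^ (n + 1)‖ * 1 := by
            gcongr
            refine (norm_sub_le_max'' c 1).trans (max_le hc (by rw [norm_one]))
        _ < 1 := by rw [mul_one]; exact hqn
    have heq : (1 - 2 * q ^ (n + 1) * c + q ^ (2 * (n + 1))) ^ 2 / (1 - q ^ (n + 1)) ^ 4 =
        (1 - 2 * q ^ (n + 1) * c + (q ^ (n + 1)) ^ 2) ^ 2 / (1 - q ^ (n + 1)) ^ 4 := by
      rw [← pow_mul, mul_comm (n + 1) 2]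
    rw [heq, (Padic.norm_eq_of_norm_sub_lt_right (hlt.trans_eq norm_one.symm)), norm_one]
  · have hqn : ‖q ^ (n + 1)‖ < 1 := by rw [norm_pow]; exact pow_lt_one₀ (norm_nonneg _) hq (by omega)
    have heq : (1 - 2 * q ^ (n + 1) * c + q ^ (2 * (n + 1))) ^ 2 / (1 - q ^ (n + 1)) ^ 4 =
        (1 - 2 * q ^ (n + 1) * c + (q ^ (n + 1)) ^ 2) ^ 2 / (1 - q ^ (n + 1)) ^ 4 := by
      rw [← pow_mul, mul_comm (n + 1) 2]
    rw [heq]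
    refine (norm_tateSigmaSq_factor_sub_one_le hqn hc).trans ?_
    rw [norm_pow, pow_succ]
    calc ‖q‖ ^ n * ‖q‖ * ‖c - 1‖ ≤ 1 * ‖q‖ * ‖c - 1‖ := by
          gcongr; exact pow_le_one₀ (norm_nonneg _) hq.le
      _ = ‖q‖ * ‖c - 1‖ := by rw [one_mul]

/-- **`σ² ≡ 18 (mod 81)`**: for `‖q‖₃ ≤ 3⁻¹` and `‖(c − 1) − 9‖₃ ≤ 3⁻⁴`,
`‖tateSigmaSq q c − 18‖₃ ≤ 3⁻⁴` (`σ² = 2(c − 1)·Π`, `‖Π − 1‖ ≤ 3⁻¹·3⁻²`). [cite: SteinWuthrich2013, §4.2] -/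
theorem norm_tateSigmaSq_sub_le {q c : ℚ_[3]} (hq : ‖q‖ ≤ 1 / 3) (hc9 : ‖(c - 1) - 9‖ ≤ 1 / 81) :
    ‖tateSigmaSq q c - 18‖ ≤ 1 / 81 := by
  have hq1 : ‖q‖ < 1 := hq.trans_lt (by norm_num)
  have h9 : ‖(9 : ℚ_[3])‖ ≤ 1 / 9 := by
    rw [show (9 : ℚ_[3]) = ((9 : ℤ) : ℚ_[3]) by norm_cast]
    exact ((Padic.norm_int_le_pow_iff_dvd (p := 3) 9 2).mpr (by norm_num)).trans (by norm_num)
  have hc1 : ‖c - 1‖ ≤ 1 / 9 := by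
    have : c - 1 = ((c - 1) - 9) + 9 := by ring
    rw [this]; exact (IsUltrametricDist.norm_add_le_max _ _).trans (max_le (hc9.trans (by norm_num)) h9)
  have hc : ‖c‖ ≤ 1 := by
    have : c = (c - 1) + 1 := by ring
    rw [this]; exact (IsUltrametricDist.norm_add_le_max _ _).trans (max_le (hc1.trans (by norm_num)) (by rw [norm_one]))
  have hP := norm_tprod_tateSigmaSq_factor_sub_one_le hq1 hc
  set P := ∏' n : ℕ, (1 - 2 * q ^ (n + 1) * c + q ^ (2 * (n + 1))) ^ 2 / (1 - q ^ (n + 1)) ^ 4 with hPdef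
  have hdef : tateSigmaSq q c = 2 * (c - 1) * P := by rw [tateSigmaSq]
  rw [hdef]
  have hsplit : 2 * (c - 1) * P - 18 = 2 * (c - 1) * (P - 1) + 2 * ((c - 1) - 9) := by ring
  rw [hsplit]
  have h2 : ‖(2 : ℚ_[3])‖ ≤ 1 := by
    rw [show (2 : ℚ_[3]) = ((2 : ℤ) : ℚ_[3]) by norm_cast]; exact Padic.norm_int_le_one _
  refine (IsUltrametricDist.norm_add_le_max _ _).trans (max_le ?_ ?_)
  · rw [norm_mul, norm_mul]
    calc ‖(2 : ℚ_[3])‖ * ‖c - 1‖ * ‖P - 1‖ ≤ 1 * (1 / 9) * (‖q‖ * ‖c - 1‖) := by gcongr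
      _ ≤ 1 * (1 / 9) * (1 / 3 * (1 / 9)) := by gcongr
      _ ≤ 1 / 81 := by norm_num
  · rw [norm_mul]
    calc ‖(2 : ℚ_[3])‖ * ‖(c - 1) - 9‖ ≤ 1 * (1 / 81) := by gcongr
      _ = 1 / 81 := one_mul _

/-- **The σ² bound of part 1 from `w ≡ −9 (mod 81)`**: for `‖q‖₃ ≤ 3⁻¹` and `‖w − 72‖₃ ≤ 3⁻⁴`,
`‖tateSigmaSq q (coshOfSq w) − 18‖₃ ≤ 3⁻⁴`. [cite: SteinWuthrich2013, §4.2] -/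
theorem norm_tateSigmaSq_coshOfSq_sub_le {q w : ℚ_[3]} (hq : ‖q‖ ≤ 1 / 3) (hw : ‖w - 72‖ ≤ 1 / 81) :
    ‖tateSigmaSq q (coshOfSq w) - 18‖ ≤ 1 / 81 :=
  norm_tateSigmaSq_sub_le hq (norm_coshOfSq_sub_one_sub_nine_le hw)

end Summit.BirchSwinnertonDyer.Rank1Residual.X11b.RegMult.Rung62310y1
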